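import Mathlib
import Summits.Ventures.HodgeRepro.PeriodCloserC7Stability

/-!
# GaussSumEvenConductor — the Gauss sum of a character of even conductor is a stationary phase in ONE point;
the root number on the model in closed form; conjugate duality pins the point to the `σ`-fixed ring

Blind re-derivation cell `pub-hodge-repro`, seat night-2 (gen 5).  Target tree path
`lean/Summits/Ventures/HodgeRepro/GaussSumEvenConductor.lean`.  The common core of every closed-form root number
landed at the places of `S₃` of the octic point — `OcticCMPointDualModel.gauss_tameWild` (`𝔭 | 5`, `c = 2`),
`OcticCMPointTruncFour.gaussSum_twist_four` (`𝔭 | 5`, `c = 4`), `OcticCMPointGaloisRingChars.gaussSum_omega` (`𝔮 | 2`,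
`c = 2`) — stated ONCE on gen 1's finite-ring model (`GaussSumStability.lean`, `PeriodCloserC7Stability.lean`):

* **`sum_units_eq_card_mul` / `gaussSum_eq_of_primitive`.**  On a finite commutative ring `R` with an ideal `I`,
  `I · I = 0`, whose `ψ`-annihilator is `I` itself (`hA` — for `R = 𝒪/𝔭^{2m}`, `I = 𝔭^m/𝔭^{2m}` and a primitive
  `ψ̃`: the EVEN-conductor situation), a character `ρ` with `ρ(1 + z) = ψ(a z)` on `I`, `a` a unit (conductor exactly
  `2m`), has `∑_{y ∈ R^×} ρ(y) ψ(y) = |I| · ρ(−a) ψ(−a)`: gen 1's coset averaging (`sum_eq_sum_psiAnn`) leaves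
  the units `y` with `a + y ∈ I`, i.e. the single coset `−a(1 + I)`, on which `ρ(y) ψ(y)` is constant.
* **`LocalChar.eps_eq_of_primitive`.**  Kudla's `ε(½, ρ, ψ) = ρ(ϖ)^n κ 𝔤(ρ⁻¹, ψ)` (Prop. 3.8 (ii), p0109:L3–L11;
  `κ |I| = 1`, i.e. `κ = |R|^{−1/2}`) is then **`ε(½, ρ, ψ) = ρ(ϖ)^n · ρ(a)^{−1} ψ(a)`** — the root number of a
  character of even conductor is its value at the stationary point.
* **`conj_sub_mem_of_conjDual`.**  For an involution `σ` of `R` with `σ(I) ⊆ I` and `ψ ∘ σ = ψ ∘ (−1 ·)`, conjugate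
  duality `ρ ∘ σ = ρ⁻¹` forces `σ(a) ≡ a` mod `I`; if `a ≡ a₀` with `a₀` a `σ`-FIXED unit
  (**`LocalChar.eps_eq_of_conjDual`**) then `ε(½, ρ, ψ) = ρ(ϖ)^n · ρ(a₀)^{−1} ψ(a₀)` with `ρ(a₀)² = 1` and
  `ψ(a₀)² = 1` (`mulChar_sq_eq_one_of_conjGR_fixed`, `addChar_sq_eq_one_of_conjGR_fixed`): the sign of a
  conjugate-dual root number is the product of the two signs `ρ(a₀)`, `ψ(a₀)` read on the `σ`-fixed subring — and
  **`LocalChar.eps_eq_piVal_pow_of_trivial`**: `ε = ρ(ϖ)^n` exactly when `ρ` and `ψ` are trivial on the `σ`-fixed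
  units / elements, the shape of the unramified place (`OcticCMPointGaloisRingE3.eps_eq_piVal_pow_two` is that
  instance on `GR(4, 4)`: `ψ̃_δ(t) = 1` for `σ`-fixed `t` since `δ` has trace zero, `θ^{k₀} = 1` since `θ⁵ = 1`).

Everything is a finite-ring identity; the printed input is Kudla (3.32) as transcribed in gen 1
(`book:editornd-introduction-langlands-program` p0109:L3–L11, L33).  The classical statement behind
`eps_eq_of_conjDual` — Fröhlich–Queyrut's `ε(½, χ, ψ_{K/k}) = χ(δ)` for `χ|_{k^×} = 1` — is NOT held and is not
claimed; what is proved is its even-conductor shape on the model.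

**What this is not.**  Odd conductors (`c = 2m + 1`: a quadratic Gauss sum survives — `OcticCMPointTruncThree`),
the construction of the rings `𝒪/𝔭^c` (the `OcticCMPoint*Model` files), and any global statement are NOT here.
Nothing here says anything about the status of the Hodge conjecture for CM abelian varieties, which is NOT proved.
-/

set_option autoImplicit false

noncomputable section

open Finset Classical

namespace Summit.Ventures.HodgeRepro.GaussSumStability

variable {R : Type} [CommRing R] [Fintype R]

/-! ### The stationary phase in one point -/

/-- **The Gauss sum of a character of even conductor, over the units**: if `I · I = 0`, the `ψ`-annihilator of `I`
is `I`, and `ρ(1 + z) = ψ(a z)` on `I` with `a` a unit, then `∑_{y ∈ R^×} ρ(y) ψ(y) = |I| · ρ(−a) ψ(−a)` — the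
coset averaging leaves exactly the coset `−a (1 + I)`, on which `ρ(y) ψ(y) = ρ(−a) ψ(−a)`. -/
theorem sum_units_eq_card_mul (ψ : AddChar R ℂ) (I : Ideal R) (hI : ∀ z ∈ I, ∀ z' ∈ I, z * z' = 0)
    (hA : ∀ x, PsiAnn ψ I x ↔ x ∈ I) (ρ : MulChar R ℂ) (a : Rˣ) (hρ : ∀ z ∈ I, ρ (1 + z) = ψ (a * z)) :
    ∑ y : Rˣ, ρ y * ψ y = (Fintype.card I : ℂ) * (ρ (-(a : R)) * ψ (-(a : R))) := by
  rw [sum_eq_sum_psiAnn ψ I hI (fun x => ρ x) a (fun y z hz => by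
      show ρ ((y : R) * (1 + z)) = ρ y * ψ (a * z)
      rw [map_mul, hρ z hz])]
  simp_rw [hA]
  rw [← sum_filter, show (Fintype.card I : ℂ) * (ρ (-(a : R)) * ψ (-(a : R))) =
      ∑ _z : I, ρ (-(a : R)) * ψ (-(a : R)) by rw [sum_const, card_univ, nsmul_eq_mul]]
  symm
  refine sum_bij (fun z _ => (-a : Rˣ) * unitOfSqZero (z : R) (hI z z.2 z z.2)) ?_ ?_ ?_ ?_
  · intro z _
    simp only [mem_filter, mem_univ, true_and]
    rw [Units.val_mul, unitOfSqZero_val, Units.val_neg,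
      show (a : R) + -(a : R) * (1 + (z : R)) = -(a : R) * z by ring]
    exact I.mul_mem_left _ z.2
  · intro z _ z' _ h
    have h1 : unitOfSqZero (z : R) (hI z z.2 z z.2) = unitOfSqZero (z' : R) (hI z' z'.2 z' z'.2) :=
      mul_left_cancel h
    have h2 : (1 : R) + z = 1 + z' := by
      have := congrArg Units.val h1
      rwa [unitOfSqZero_val, unitOfSqZero_val] at this
    exact Subtype.ext (add_left_cancel h2)
  · intro y hy
    simp only [mem_filter, mem_univ, true_and] at hy
    refine ⟨⟨-((a⁻¹ : Rˣ) : R) * ((a : R) + y), I.mul_mem_left _ hy⟩, mem_univ _, ?_⟩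
    apply Units.ext
    rw [Units.val_mul, unitOfSqZero_val, Units.val_neg]
    have hinv := Units.mul_inv a
    linear_combination ((a : R) + y) * hinv
  · intro z _
    rw [Units.val_mul, unitOfSqZero_val, Units.val_neg, map_mul, hρ z z.2, mul_add, mul_one,
      AddChar.map_add_eq_mul]
    have h1 : ψ (a * z) * ψ (-(a : R) * z) = 1 := by
      rw [← AddChar.map_add_eq_mul, neg_mul, add_neg_cancel, AddChar.map_zero_eq_one]
    linear_combination (-(ρ (-(a : R)) * ψ (-(a : R)))) * h1

/-- **The Gauss sum of a character of even conductor** (Mathlib's normalisation):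
`gaussSum ρ ψ = |I| · ρ(−a) ψ(−a)`. -/
theorem gaussSum_eq_of_primitive (ψ : AddChar R ℂ) (I : Ideal R) (hI : ∀ z ∈ I, ∀ z' ∈ I, z * z' = 0)
    (hA : ∀ x, PsiAnn ψ I x ↔ x ∈ I) (ρ : MulChar R ℂ) (a : Rˣ) (hρ : ∀ z ∈ I, ρ (1 + z) = ψ (a * z)) :
    gaussSum ρ ψ = (Fintype.card I : ℂ) * (ρ (-(a : R)) * ψ (-(a : R))) := by
  rw [gaussSum_eq_sum_units, sum_units_eq_card_mul ψ I hI hA ρ a hρ]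

omit [Fintype R] in
/-- The inverse character has the stationary point `−a`: `ρ⁻¹(1 + z) = ψ(−a z)` on `I`. -/
theorem inv_primitive (ψ : AddChar R ℂ) (I : Ideal R) (ρ : MulChar R ℂ) (a : Rˣ)
    (hρ : ∀ z ∈ I, ρ (1 + z) = ψ (a * z)) :
    ∀ z ∈ I, ρ⁻¹ (1 + z) = ψ (((-a : Rˣ) : R) * z) := by
  intro z hz
  rw [MulChar.inv_apply_eq_inv', hρ z hz, Units.val_neg, neg_mul, AddChar.map_neg_eq_inv]

/-- **Kudla's Gauss sum `𝔤(ρ, ψ) = ∑ ρ⁻¹(y) ψ(y)` of a character of even conductor**: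
`gaussSum ρ⁻¹ ψ = |I| · ρ(a)^{−1} ψ(a)`. -/
theorem gaussSum_inv_eq_of_primitive (ψ : AddChar R ℂ) (I : Ideal R) (hI : ∀ z ∈ I, ∀ z' ∈ I, z * z' = 0)
    (hA : ∀ x, PsiAnn ψ I x ↔ x ∈ I) (ρ : MulChar R ℂ) (a : Rˣ) (hρ : ∀ z ∈ I, ρ (1 + z) = ψ (a * z)) :
    gaussSum ρ⁻¹ ψ = (Fintype.card I : ℂ) * ((ρ (a : R))⁻¹ * ψ (a : R)) := by
  rw [gaussSum_eq_of_primitive ψ I hI hA ρ⁻¹ (-a) (inv_primitive ψ I ρ a hρ), Units.val_neg, neg_neg,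
    MulChar.inv_apply_eq_inv']

/-! ### Conjugate duality pins the stationary point to the `σ`-fixed subring -/

omit [Fintype R] in
/-- **Conjugate duality forces `σ(a) ≡ a` mod `I`**: for an involution `σ` with `σ(I) ⊆ I` and
`ψ ∘ σ = ψ ∘ (−1 ·)`, a character `ρ` with `ρ ∘ σ = ρ⁻¹` and `ρ(1 + z) = ψ(a z)` on `I` has
`ψ((a − σ(a)) z) = 1` for all `z ∈ I`, i.e. `a − σ(a)` in the `ψ`-annihilator of `I`, which is `I`. -/
theorem conj_sub_mem_of_conjDual (ψ : AddChar R ℂ) (I : Ideal R) (hA : ∀ x, PsiAnn ψ I x ↔ x ∈ I)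
    (σ : R →+* R) (hσσ : ∀ x, σ (σ x) = x) (hσI : ∀ z ∈ I, σ z ∈ I) (hψσ : ∀ x, ψ (σ x) = ψ (-x))
    (ρ : MulChar R ℂ) (hρσ : ∀ x, ρ (σ x) = ρ⁻¹ x) (a : Rˣ) (hρ : ∀ z ∈ I, ρ (1 + z) = ψ (a * z)) :
    σ (a : R) - a ∈ I := by
  have key : PsiAnn ψ I ((a : R) - σ (a : R)) := by
    intro z hz
    -- `ρ(1 + σ z) = ρ(σ(1 + z)) = ρ⁻¹(1 + z) = ψ(a z)⁻¹ = ψ(−a z)`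
    have h1 : ρ (1 + σ z) = ψ (-((a : R) * z)) := by
      rw [← map_one σ, ← map_add, hρσ, MulChar.inv_apply_eq_inv', hρ z hz, AddChar.map_neg_eq_inv]
    -- `ρ(1 + σ z) = ψ(a σ z) = ψ(σ(σ(a) z)) = ψ(−σ(a) z)`
    have h2 : ρ (1 + σ z) = ψ (-(σ (a : R) * z)) := by
      rw [hρ (σ z) (hσI z hz), ← hψσ, map_mul σ, hσσ]
    have h3 : ψ (-((a : R) * z)) = ψ (-(σ (a : R) * z)) := h1.symm.trans h2
    calc ψ (((a : R) - σ (a : R)) * z) = ψ (-(σ (a : R) * z)) * ψ ((a : R) * z) := by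
          rw [← AddChar.map_add_eq_mul]; congr 1; ring
      _ = ψ (-((a : R) * z)) * ψ ((a : R) * z) := by rw [h3]
      _ = 1 := by rw [← AddChar.map_add_eq_mul, neg_add_cancel, AddChar.map_zero_eq_one]
  have := (hA _).1 key
  rw [← neg_sub] at this
  exact (I.neg_mem_iff).1 this

omit [Fintype R] in
/-- A conjugate-dual character is `±1` on the `σ`-fixed units: `ρ(u) = ρ(σ u) = ρ(u)^{−1}`. -/
theorem mulChar_sq_eq_one_of_conjGR_fixed (σ : R →+* R) (ρ : MulChar R ℂ) (hρσ : ∀ x, ρ (σ x) = ρ⁻¹ x)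
    (u : Rˣ) (hu : σ (u : R) = u) : ρ (u : R) * ρ (u : R) = 1 := by
  have hne : ρ (u : R) ≠ 0 := by
    intro h
    have := ρ.map_one
    rw [← Units.mul_inv u, map_mul, h, zero_mul] at this
    exact zero_ne_one this
  calc ρ (u : R) * ρ (u : R) = ρ (u : R) * ρ (σ (u : R)) := by rw [hu]
    _ = ρ (u : R) * (ρ (u : R))⁻¹ := by rw [hρσ, MulChar.inv_apply_eq_inv']
    _ = 1 := mul_inv_cancel₀ hne

omit [Fintype R] in
/-- A `σ`-compatible additive character is `±1` on the `σ`-fixed elements: `ψ(t) = ψ(σ t) = ψ(−t)`. -/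
theorem addChar_sq_eq_one_of_conjGR_fixed (σ : R →+* R) (ψ : AddChar R ℂ) (hψσ : ∀ x, ψ (σ x) = ψ (-x))
    (t : R) (ht : σ t = t) : ψ t * ψ t = 1 := by
  calc ψ t * ψ t = ψ t * ψ (σ t) := by rw [ht]
    _ = ψ t * ψ (-t) := by rw [hψσ]
    _ = 1 := by rw [← AddChar.map_add_eq_mul, add_neg_cancel, AddChar.map_zero_eq_one]

omit [Fintype R] in
/-- **The value `ρ(a)^{−1} ψ(a)` only depends on `a` mod `I`**: for `a = a₀ + w`, `w ∈ I`,
`ρ(a) = ρ(a₀) ψ(a · a₀^{−1} w) = ρ(a₀) ψ(w)` (`w · a₀^{−1} w ∈ I · I = 0`) and `ψ(a) = ψ(a₀) ψ(w)`. -/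
theorem inv_mul_eq_of_sub_mem (ψ : AddChar R ℂ) (I : Ideal R) (hI : ∀ z ∈ I, ∀ z' ∈ I, z * z' = 0)
    (ρ : MulChar R ℂ) (a : Rˣ) (hρ : ∀ z ∈ I, ρ (1 + z) = ψ (a * z)) (a₀ : Rˣ) (ha₀ : (a : R) - a₀ ∈ I) :
    (ρ (a : R))⁻¹ * ψ (a : R) = (ρ (a₀ : R))⁻¹ * ψ (a₀ : R) := by
  set w : R := (a : R) - a₀ with hw
  have hz : ((a₀⁻¹ : Rˣ) : R) * w ∈ I := I.mul_mem_left _ ha₀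
  have ha : (a : R) = a₀ * (1 + ((a₀⁻¹ : Rˣ) : R) * w) := by
    have := Units.mul_inv a₀
    linear_combination (-w) * this
  have hρa : ρ (a : R) = ρ (a₀ : R) * ψ w := by
    rw [ha, map_mul, hρ _ hz]
    congr 2
    -- `a · a₀⁻¹ w = (a₀ + w) a₀⁻¹ w = w + w · a₀⁻¹ w = w`
    have h0 : w * (((a₀⁻¹ : Rˣ) : R) * w) = 0 := hI w ha₀ _ hz
    have := Units.mul_inv a₀
    linear_combination w * this + h0 - (((a₀⁻¹ : Rˣ) : R) * w) * hw
  have hψa : ψ (a : R) = ψ (a₀ : R) * ψ w := by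
    rw [← AddChar.map_add_eq_mul]
    congr 1
    rw [hw]; ring
  have hwne : ψ w ≠ 0 := by
    intro h
    have := AddChar.map_add_eq_mul ψ w (-w)
    rw [add_neg_cancel, AddChar.map_zero_eq_one, h, zero_mul] at this
    exact one_ne_zero this
  rw [hρa, hψa, mul_inv]
  field_simp

end Summit.Ventures.HodgeRepro.GaussSumStability

namespace Summit.Ventures.HodgeRepro.PeriodCloser.LocalChar

open GaussSumStability

variable {R : Type} [CommRing R] [Fintype R]

/-! ### The root number on the model -/

/-- **The root number of a character of even conductor, in closed form** (Kudla Prop. 3.8 (ii) on the model,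
`κ |I| = 1`): `ε(½, ρ, ψ) = ρ(ϖ)^n · ρ(a)^{−1} ψ(a)` for `ρ(1 + z) = ψ(a z)` on `I`, `a` a unit. -/
theorem eps_eq_of_primitive (κ : ℂ) (n : ℕ) (ρ : LocalChar R) (ψ : AddChar R ℂ) (I : Ideal R)
    (hI : ∀ z ∈ I, ∀ z' ∈ I, z * z' = 0) (hA : ∀ x, PsiAnn ψ I x ↔ x ∈ I) (a : Rˣ)
    (hρ : Primitive ψ I ρ a) (hκ : κ * (Fintype.card I : ℂ) = 1) :
    eps κ n ρ ψ = ρ.piVal ^ n * ((ρ.unit (a : R))⁻¹ * ψ (a : R)) := by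
  unfold eps gauss
  rw [gaussSum_inv_eq_of_primitive ψ I hI hA ρ.unit a hρ]
  calc ρ.piVal ^ n * κ * ((Fintype.card I : ℂ) * ((ρ.unit (a : R))⁻¹ * ψ (a : R))) =
      ρ.piVal ^ n * (κ * (Fintype.card I : ℂ)) * ((ρ.unit (a : R))⁻¹ * ψ (a : R)) := by ring
    _ = _ := by rw [hκ, mul_one]

omit [Fintype R] in
/-- **Conjugate duality pins the stationary point**: `σ(a) ≡ a` mod `I` (`conj_sub_mem_of_conjDual` for the
unit part of a `LocalChar`). -/
theorem conj_sub_mem (ψ : AddChar R ℂ) (I : Ideal R) (hA : ∀ x, PsiAnn ψ I x ↔ x ∈ I) (σ : R →+* R)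
    (hσσ : ∀ x, σ (σ x) = x) (hσI : ∀ z ∈ I, σ z ∈ I) (hψσ : ∀ x, ψ (σ x) = ψ (-x)) (ρ : LocalChar R)
    (hρσ : ∀ x, ρ.unit (σ x) = ρ.unit⁻¹ x) (a : Rˣ) (hρ : Primitive ψ I ρ a) : σ (a : R) - a ∈ I :=
  conj_sub_mem_of_conjDual ψ I hA σ hσσ hσI hψσ ρ.unit hρσ a hρ

/-- **The root number of a conjugate-dual character of even conductor is read on the `σ`-fixed subring**: if the
stationary point `a` is congruent mod `I` to a `σ`-fixed unit `a₀`, then `ε(½, ρ, ψ) = ρ(ϖ)^n · ρ(a₀)^{−1} ψ(a₀)`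
with `ρ(a₀)² = 1` and `ψ(a₀)² = 1` — the sign is the product of the two signs `ρ(a₀)`, `ψ(a₀)`. -/
theorem eps_eq_of_conjDual (κ : ℂ) (n : ℕ) (ρ : LocalChar R) (ψ : AddChar R ℂ) (I : Ideal R)
    (hI : ∀ z ∈ I, ∀ z' ∈ I, z * z' = 0) (hA : ∀ x, PsiAnn ψ I x ↔ x ∈ I) (σ : R →+* R)
    (hρσ : ∀ x, ρ.unit (σ x) = ρ.unit⁻¹ x) (hψσ : ∀ x, ψ (σ x) = ψ (-x)) (a : Rˣ)
    (hρ : Primitive ψ I ρ a) (hκ : κ * (Fintype.card I : ℂ) = 1) (a₀ : Rˣ) (hσa₀ : σ (a₀ : R) = a₀)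
    (ha₀ : (a : R) - a₀ ∈ I) :
    eps κ n ρ ψ = ρ.piVal ^ n * ((ρ.unit (a₀ : R))⁻¹ * ψ (a₀ : R)) ∧
      ρ.unit (a₀ : R) * ρ.unit (a₀ : R) = 1 ∧ ψ (a₀ : R) * ψ (a₀ : R) = 1 := by
  refine ⟨?_, mulChar_sq_eq_one_of_conjGR_fixed σ ρ.unit hρσ a₀ hσa₀,
    addChar_sq_eq_one_of_conjGR_fixed σ ψ hψσ (a₀ : R) hσa₀⟩
  rw [eps_eq_of_primitive κ n ρ ψ I hI hA a hρ hκ, inv_mul_eq_of_sub_mem ψ I hI ρ.unit a hρ a₀ ha₀]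

/-- **`ε(½, ρ, ψ) = ρ(ϖ)^n` exactly** when the stationary point `a ≡ a₀` (mod `I`) with `ρ(a₀) = 1` and
`ψ(a₀) = 1` — e.g. `ρ` trivial on the `σ`-fixed units and `ψ` trivial on the `σ`-fixed elements (the unramified
place: `OcticCMPointGaloisRingE3.eps_eq_piVal_pow_two` on `GR(4, 4)`). -/
theorem eps_eq_piVal_pow_of_trivial (κ : ℂ) (n : ℕ) (ρ : LocalChar R) (ψ : AddChar R ℂ) (I : Ideal R)
    (hI : ∀ z ∈ I, ∀ z' ∈ I, z * z' = 0) (hA : ∀ x, PsiAnn ψ I x ↔ x ∈ I) (a : Rˣ)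
    (hρ : Primitive ψ I ρ a) (hκ : κ * (Fintype.card I : ℂ) = 1) (a₀ : Rˣ) (ha₀ : (a : R) - a₀ ∈ I)
    (hρ₀ : ρ.unit (a₀ : R) = 1) (hψ₀ : ψ (a₀ : R) = 1) :
    eps κ n ρ ψ = ρ.piVal ^ n := by
  rw [eps_eq_of_primitive κ n ρ ψ I hI hA a hρ hκ, inv_mul_eq_of_sub_mem ψ I hI ρ.unit a hρ a₀ ha₀, hρ₀, hψ₀]
  ring

/-- **(E3) for four lines of even conductor with stationary points `a_j` in closed form**: `ε₀ε₁ = ε₂ε₃` iff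
`(π₀π₁)^n ρ₀(a₀)^{−1}ρ₁(a₁)^{−1} ψ(a₀)ψ(a₁) = (π₂π₃)^n ρ₂(a₂)^{−1}ρ₃(a₃)^{−1} ψ(a₂)ψ(a₃)` — the residual
finite-place identity of ROUTE.md §4 item 2 (9)(d) as an identity of values at the stationary points. -/
theorem E3_iff_of_primitive (κ : ℂ) (n : ℕ) (ρ : Fin 4 → LocalChar R) (ψ : AddChar R ℂ) (I : Ideal R)
    (hI : ∀ z ∈ I, ∀ z' ∈ I, z * z' = 0) (hA : ∀ x, PsiAnn ψ I x ↔ x ∈ I) (a : Fin 4 → Rˣ)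
    (hρ : ∀ j, Primitive ψ I (ρ j) (a j)) (hκ : κ * (Fintype.card I : ℂ) = 1) :
    (eps κ n (ρ 0) ψ * eps κ n (ρ 1) ψ = eps κ n (ρ 2) ψ * eps κ n (ρ 3) ψ) ↔
      ((ρ 0).piVal * (ρ 1).piVal) ^ n *
          (((ρ 0).unit (a 0 : R))⁻¹ * ψ (a 0 : R) * (((ρ 1).unit (a 1 : R))⁻¹ * ψ (a 1 : R))) =
        ((ρ 2).piVal * (ρ 3).piVal) ^ n *
          (((ρ 2).unit (a 2 : R))⁻¹ * ψ (a 2 : R) * (((ρ 3).unit (a 3 : R))⁻¹ * ψ (a 3 : R))) := by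
  rw [eps_eq_of_primitive κ n (ρ 0) ψ I hI hA (a 0) (hρ 0) hκ,
    eps_eq_of_primitive κ n (ρ 1) ψ I hI hA (a 1) (hρ 1) hκ,
    eps_eq_of_primitive κ n (ρ 2) ψ I hI hA (a 2) (hρ 2) hκ,
    eps_eq_of_primitive κ n (ρ 3) ψ I hI hA (a 3) (hρ 3) hκ, mul_pow, mul_pow]
  constructor <;> intro h <;> linear_combination h

end Summit.Ventures.HodgeRepro.PeriodCloser.LocalChar

end
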